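import Summits.Ventures.PercRepro.S1RankProfileDoubleCount

/-!
# PercRepro — THE RANK PROFILE OF A CIRCUIT (p2, gen 28; SUBCLAIM-S1 §6.10 (xvii)(b))

A matroid whose ground set is a circuit of `s + 1` elements has rank `s`; every proper subset is independent, so
its rank-level sets and two-dimensional profile are explicit: `f(a) ≥ C(s + 1, a)` for `a ≤ s`, `f(s) ≥ s + 2`
(the `s`-subsets and the ground set), `N(s, 0) ≤ 1` (the ground set only), `N(s, 1) ≤ s + 1` (the `s`-subsets),
`N(s, b) = ∅` for `b ≥ 2`, and nothing above rank `s`. These are the circuit-summand entries of the exact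
factorisation of `S1DisjointSumU` / `S1DisjointSumY`. With them a general counting lemma, `C(|E|, k)` subsets of
size `k`. Nothing is claimed about any cell.

* `ncard_setOf_subset_ncard_eq` — a finite set of `n` elements has `C(n, k)` subsets of size `k`;
* `rankSet_eq_empty_of_eRank_lt`, `profileSet_eq_empty_of_eRank_lt` — nothing above the rank;
* `eRk_eq_ncard_of_ssubset_of_isCircuit_ground`, `eRank_eq_of_isCircuit_ground` — ranks in a circuit;
* `choose_le_ncard_rankSet_of_isCircuit_ground`, `ncard_rankSet_top_of_isCircuit_ground` — the rank profile;
* `ncard_profileSet_top_zero_le`, `ncard_profileSet_top_one_le`, `profileSet_top_eq_empty_of_two_le` — the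
  two-dimensional profile at the top rank.
Axioms: standard.
-/

open scoped Matroid

namespace PercRepro

namespace S1

open Set

variable {α : Type}

/-- **Subsets of size `k` of a finite set `E` number `C(|E|, k)`.** -/
theorem ncard_setOf_subset_ncard_eq {E : Set α} (hE : E.Finite) (k : ℕ) :
    {A : Set α | A ⊆ E ∧ A.ncard = k}.ncard = Nat.choose E.ncard k := by
  have himage : {A : Set α | A ⊆ E ∧ A.ncard = k} =
      (fun B : Finset α => (B : Set α)) ''
        ((Finset.powersetCard k hE.toFinset : Finset (Finset α)) : Set (Finset α)) := by
    ext A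
    simp only [mem_setOf_eq, mem_image, Finset.mem_coe, Finset.mem_powersetCard]
    constructor
    · rintro ⟨hAE, hAk⟩
      have hAfin : A.Finite := hE.subset hAE
      refine ⟨hAfin.toFinset, ⟨Finite.toFinset_subset_toFinset.mpr hAE, ?_⟩, hAfin.coe_toFinset⟩
      rw [← ncard_eq_toFinset_card A hAfin]
      exact hAk
    · rintro ⟨B, ⟨hBE, hBk⟩, rfl⟩
      refine ⟨?_, ?_⟩
      · intro x hx
        have hx' : x ∈ hE.toFinset := hBE (Finset.mem_coe.mp hx)
        rwa [Finite.mem_toFinset] at hx'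
      · rw [ncard_coe_finset]
        exact hBk
  rw [himage, ncard_image_of_injective _ Finset.coe_injective, ncard_coe_finset,
    Finset.card_powersetCard, ncard_eq_toFinset_card E hE]

/-- No subset has rank above the rank of the matroid: the rank-level sets above `eRank` are empty. -/
theorem rankSet_eq_empty_of_eRank_lt (M : Matroid α) {r a : ℕ} (hr : M.eRank = r) (ha : r < a) :
    rankSet M a = ∅ := by
  rw [eq_empty_iff_forall_notMem]
  rintro A ⟨-, hA⟩
  have h := M.eRk_le_eRank A
  rw [hA, hr] at h
  have h' : a ≤ r := by exact_mod_cast h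
  omega

/-- The profile sets above the rank of the matroid are empty. -/
theorem profileSet_eq_empty_of_eRank_lt (M : Matroid α) {r a : ℕ} (hr : M.eRank = r) (ha : r < a) (b : ℕ) :
    profileSet M a b = ∅ := by
  rw [eq_empty_iff_forall_notMem]
  rintro A ⟨-, hA, -⟩
  have h := M.eRk_le_eRank A
  rw [hA, hr] at h
  have h' : a ≤ r := by exact_mod_cast h
  omega

/-- A profile set is contained in the rank-level set of its first index. -/
theorem profileSet_subset_rankSet (M : Matroid α) (a b : ℕ) : profileSet M a b ⊆ rankSet M a :=
  fun _ hA => ⟨hA.1, hA.2.1⟩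

variable {N : Matroid α}

/-- A proper subset of a circuit ground set is independent: its rank is its cardinality. -/
theorem eRk_eq_ncard_of_ssubset_of_isCircuit_ground [N.Finite] (hC : N.IsCircuit N.E) {A : Set α}
    (hA : A ⊂ N.E) : N.eRk A = A.ncard := by
  rw [(hC.ssubset_indep hA).eRk_eq_encard, (N.ground_finite.subset hA.subset).cast_ncard_eq]

/-- The rank of a matroid whose ground set is a circuit of `s + 1` elements is `s`. -/
theorem eRank_eq_of_isCircuit_ground [N.Finite] (hC : N.IsCircuit N.E) {s : ℕ} (hs : N.E.ncard = s + 1) :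
    N.eRank = s := by
  have h := hC.eRk_add_one_eq
  rw [N.eRk_ground, ← N.ground_finite.cast_ncard_eq, hs] at h
  have hlt : N.eRank < ⊤ :=
    lt_of_le_of_lt (by rw [N.eRank_def]; exact N.eRk_le_encard N.E) N.ground_finite.encard_lt_top
  obtain ⟨n, hn⟩ := ENat.ne_top_iff_exists.mp hlt.ne
  rw [← hn] at h ⊢
  have h2 : n + 1 = s + 1 := by exact_mod_cast h
  have h3 : n = s := by omega
  rw [h3]

/-- **The rank profile of a circuit, below the top**: for `a ≤ s`, every `a`-subset of the ground set (a
circuit of `s + 1` elements) has rank `a`, so `f(a) ≥ C(s + 1, a)`. -/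
theorem choose_le_ncard_rankSet_of_isCircuit_ground [N.Finite] (hC : N.IsCircuit N.E) {s : ℕ}
    (hs : N.E.ncard = s + 1) {a : ℕ} (ha : a ≤ s) : Nat.choose (s + 1) a ≤ (rankSet N a).ncard := by
  rw [← hs, ← ncard_setOf_subset_ncard_eq N.ground_finite a]
  apply ncard_le_ncard _ (rankSet_finite N a)
  rintro A ⟨hAE, hAa⟩
  have hA : A ⊂ N.E := by
    refine ⟨hAE, fun hEA => ?_⟩
    have hEq := hAE.antisymm hEA
    rw [← hEq] at hs
    omega
  exact ⟨hAE, by rw [eRk_eq_ncard_of_ssubset_of_isCircuit_ground hC hA, hAa]⟩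

/-- **The top rank level of a circuit** of `s + 1` elements has at least `s + 2` members: the `s + 1` subsets
of size `s` and the ground set itself. -/
theorem ncard_rankSet_top_of_isCircuit_ground [N.Finite] (hC : N.IsCircuit N.E) {s : ℕ}
    (hs : N.E.ncard = s + 1) : s + 2 ≤ (rankSet N s).ncard := by
  have hE : N.E ∈ rankSet N s :=
    ⟨subset_rfl, by rw [N.eRk_ground, eRank_eq_of_isCircuit_ground hC hs]⟩
  have hsub : insert N.E {A : Set α | A ⊆ N.E ∧ A.ncard = s} ⊆ rankSet N s := by
    rintro A (rfl | ⟨hAE, hAs⟩)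
    · exact hE
    · have hA : A ⊂ N.E := by
        refine ⟨hAE, fun hEA => ?_⟩
        have hEq := hAE.antisymm hEA
        rw [← hEq] at hs
        omega
      exact ⟨hAE, by rw [eRk_eq_ncard_of_ssubset_of_isCircuit_ground hC hA, hAs]⟩
  have hnot : N.E ∉ {A : Set α | A ⊆ N.E ∧ A.ncard = s} := fun h => by
    have h2 := h.2
    omega
  have hfin : {A : Set α | A ⊆ N.E ∧ A.ncard = s}.Finite :=
    N.ground_finite.finite_subsets.subset (fun _ hA => hA.1)
  calc s + 2 = Nat.choose (s + 1) s + 1 := by rw [Nat.choose_succ_self_right]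
    _ = (insert N.E {A : Set α | A ⊆ N.E ∧ A.ncard = s}).ncard := by
        rw [ncard_insert_of_notMem hnot hfin, ncard_setOf_subset_ncard_eq N.ground_finite s, hs]
    _ ≤ (rankSet N s).ncard := ncard_le_ncard hsub (rankSet_finite N s)

/-- In a circuit of `s + 1 ≥ 2` elements the only rank-`s` set whose complement has rank `0` is the ground
set: `N(s, 0) ≤ 1`. -/
theorem ncard_profileSet_top_zero_le [N.Finite] (hC : N.IsCircuit N.E) {s : ℕ} (hs : N.E.ncard = s + 1)
    (hs1 : 1 ≤ s) : (profileSet N s 0).ncard ≤ 1 := by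
  have hsub : profileSet N s 0 ⊆ {N.E} := by
    rintro A ⟨hAE, -, hAc⟩
    rw [mem_singleton_iff]
    by_contra hne
    have hne' : (N.E \ A).Nonempty := sdiff_nonempty.mpr (fun hEA => hne (hAE.antisymm hEA))
    by_cases hcomp : N.E \ A ⊂ N.E
    · rw [eRk_eq_ncard_of_ssubset_of_isCircuit_ground hC hcomp] at hAc
      have h0 : (N.E \ A).ncard = 0 := by exact_mod_cast hAc
      rw [ncard_eq_zero (N.ground_finite.subset sdiff_subset)] at h0
      exact hne'.ne_empty h0
    · have hEq : N.E \ A = N.E := by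
        by_contra hne2
        exact hcomp (Set.ssubset_iff_subset_ne.mpr ⟨sdiff_subset, hne2⟩)
      rw [hEq, N.eRk_ground, eRank_eq_of_isCircuit_ground hC hs] at hAc
      have h0 : s = 0 := by exact_mod_cast hAc
      omega
  exact (ncard_le_ncard hsub (finite_singleton _)).trans (by rw [ncard_singleton])

/-- In a circuit of `s + 1` elements the rank-`s` sets whose complement has rank `1` are `s`-subsets:
`N(s, 1) ≤ s + 1`. -/
theorem ncard_profileSet_top_one_le [N.Finite] (hC : N.IsCircuit N.E) {s : ℕ} (hs : N.E.ncard = s + 1) :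
    (profileSet N s 1).ncard ≤ s + 1 := by
  have hsub : profileSet N s 1 ⊆ {A : Set α | A ⊆ N.E ∧ A.ncard = s} := by
    rintro A ⟨hAE, hAs, hAc⟩
    refine ⟨hAE, ?_⟩
    have hA : A ⊂ N.E := by
      refine ⟨hAE, fun hEA => ?_⟩
      have hEq := hAE.antisymm hEA
      rw [hEq, sdiff_self, N.eRk_empty] at hAc
      have h0 : (0 : ℕ) = 1 := by exact_mod_cast hAc
      omega
    rw [eRk_eq_ncard_of_ssubset_of_isCircuit_ground hC hA] at hAs
    exact_mod_cast hAs
  have hfin : {A : Set α | A ⊆ N.E ∧ A.ncard = s}.Finite :=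
    N.ground_finite.finite_subsets.subset (fun _ hA => hA.1)
  calc (profileSet N s 1).ncard ≤ {A : Set α | A ⊆ N.E ∧ A.ncard = s}.ncard := ncard_le_ncard hsub hfin
    _ = s + 1 := by rw [ncard_setOf_subset_ncard_eq N.ground_finite s, hs, Nat.choose_succ_self_right]

/-- In a circuit of `s + 1` elements no rank-`s` set has a complement of rank `b ≥ 2`: `N(s, b) = ∅`. -/
theorem profileSet_top_eq_empty_of_two_le [N.Finite] (hC : N.IsCircuit N.E) {s : ℕ} (hs : N.E.ncard = s + 1)
    {b : ℕ} (hb : 2 ≤ b) : profileSet N s b = ∅ := by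
  rw [eq_empty_iff_forall_notMem]
  rintro A ⟨hAE, hAs, hAc⟩
  by_cases hA : A ⊂ N.E
  · rw [eRk_eq_ncard_of_ssubset_of_isCircuit_ground hC hA] at hAs
    have hAs' : A.ncard = s := by exact_mod_cast hAs
    have hcard : (N.E \ A).ncard = 1 := by
      rw [ncard_sdiff' hAE N.ground_finite, hAs', hs]
      omega
    have hle := N.eRk_le_encard (N.E \ A)
    rw [hAc, ← (N.ground_finite.subset sdiff_subset).cast_ncard_eq, hcard] at hle
    have hle' : b ≤ 1 := by exact_mod_cast hle
    omega
  · have hEq : A = N.E := by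
      by_contra hne
      exact hA (Set.ssubset_iff_subset_ne.mpr ⟨hAE, hne⟩)
    rw [hEq, sdiff_self, N.eRk_empty] at hAc
    have h0 : (0 : ℕ) = b := by exact_mod_cast hAc
    omega

end S1

end PercRepro
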